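import Mathlib
import Summits.KontsevichZagierPeriods.KontsevichZagierPeriods.Theorems.SoloInformedSidePieces
import Summits.KontsevichZagierPeriods.KontsevichZagierPeriods.Theorems.SoloInformedTameMapSlackVolume
import Summits.KontsevichZagierPeriods.KontsevichZagierPeriods.Theorems.SoloInformedParamMap
import HarnessLib

/-!
# Solo-informed (A390-ii): integrability loci — generic pieces

File F5a of the KERNEL LEMMA I programme.  LEMMA I says that for a `ℚ`-semialgebraic set
`S ⊆ ℝ^{k+m}` and a `ℚ`-semialgebraic function `G` on `S`, the locus of parameters `t ∈ ℝᵏ` at which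
`∫ 1_S |G| (t, x) dx < ∞` is `ℚ`-semialgebraic (`SoloInformedFinLocusAt k m`).  This file: the
statement, the base case `m = 0`, and the generic piece lemmas — two-sided comparison, finite
covers, the NULL piece (finiteness ⟺ the fibre of a `ℚ`-semialgebraic set is Lebesgue-null ⟺ the
first-order thin-fibre clause `soloInformedThin`), the SURROGATE piece (reduction to the locus one
dimension down) and the LOGARITHMIC piece (reduction through the log-room theorem
`SoloInformedLogRoomAt`).
-/

open MeasureTheory Set Real
open scoped ENNReal
open Literature.ModelTheory.ExponentialFields Literature.NumberTheory.Transcendental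

namespace Summit.KontsevichZagierPeriods.KontsevichZagierPeriods.Theorems

/-- **LEMMA I in dimension `m` over a parameter block of length `k`**: integrability loci of
`ℚ`-semialgebraic families are `ℚ`-semialgebraic. -/
def SoloInformedFinLocusAt (k m : ℕ) : Prop :=
  ∀ (S : Set (Fin (k + m) → ℝ)) (G : (Fin (k + m) → ℝ) → ℝ), IsSemialgebraic ℚ S →
    IsSemialgebraicFunOn ℚ S G →
    IsSemialgebraic ℚ {t : Fin k → ℝ |
      ∫⁻ x, ENNReal.ofReal (S.indicator (fun w => |G w|) (Fin.append t x)) < ∞}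

/-- Base case: over `ℝ⁰` every integral is a point value, the locus is everything. -/
theorem soloInformed_finLocus_zero (k : ℕ) : SoloInformedFinLocusAt k 0 := by
  intro S G hS hG
  have h : {t : Fin k → ℝ |
      ∫⁻ x, ENNReal.ofReal (S.indicator (fun w => |G w|) (Fin.append t x)) < ∞} = univ :=
    eq_univ_of_forall fun t => (soloInformed_lintegral_fin_zero (fun x : Fin 0 → ℝ =>
      ENNReal.ofReal (S.indicator (fun w => |G w|) (Fin.append t x)))).trans_lt
        ENNReal.ofReal_lt_top
  rw [h]
  exact isSemialgebraic_univ

/-! ### Comparison and covers -/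

variable {k d : ℕ}

/-- A pointwise bound `H ≤ K H'` on `P` integrates. -/
theorem soloInformed_lintegral_indicator_append_le_mul {P : Set (Fin (k + d) → ℝ)}
    {H H' : (Fin (k + d) → ℝ) → ℝ≥0∞} {K : ℝ≥0∞} (hK : K ≠ ∞)
    (hle : ∀ w ∈ P, H w ≤ K * H' w) (t : Fin k → ℝ) :
    ∫⁻ x, P.indicator H (Fin.append t x) ≤ K * ∫⁻ x, P.indicator H' (Fin.append t x) := by
  rw [← lintegral_const_mul' _ _ hK]
  refine lintegral_mono fun x => ?_
  by_cases hx : Fin.append t x ∈ P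
  · rw [indicator_of_mem hx, indicator_of_mem hx]; exact hle _ hx
  · rw [indicator_of_notMem hx, indicator_of_notMem hx, mul_zero]

/-- **Two-sided comparison**: comparable integrands have the same finiteness. -/
theorem soloInformed_finite_iff_of_twoSided {P : Set (Fin (k + d) → ℝ)}
    {H H' : (Fin (k + d) → ℝ) → ℝ≥0∞} {K K' : ℝ≥0∞} (hK : K ≠ ∞) (hK' : K' ≠ ∞)
    (h1 : ∀ w ∈ P, H w ≤ K * H' w) (h2 : ∀ w ∈ P, H' w ≤ K' * H w) (t : Fin k → ℝ) :
    ∫⁻ x, P.indicator H (Fin.append t x) < ∞ ↔ ∫⁻ x, P.indicator H' (Fin.append t x) < ∞ :=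
  ⟨fun h => lt_of_le_of_lt (soloInformed_lintegral_indicator_append_le_mul hK' h2 t)
      (ENNReal.mul_lt_top hK'.lt_top h),
    fun h => lt_of_le_of_lt (soloInformed_lintegral_indicator_append_le_mul hK h1 t)
      (ENNReal.mul_lt_top hK.lt_top h)⟩

/-- **Finite covers**: finiteness over `B` is finiteness over every piece. -/
theorem soloInformed_finite_iff_cover {ι : Type} [Finite ι] {B : Set (Fin (k + d) → ℝ)}
    (P : ι → Set (Fin (k + d) → ℝ)) (hPB : ∀ i, P i ⊆ B) (hPm : ∀ i, MeasurableSet (P i))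
    {H : (Fin (k + d) → ℝ) → ℝ≥0∞} (hH : Measurable H)
    (hcov : ∀ w ∈ B, H w = 0 ∨ ∃ i, w ∈ P i) (t : Fin k → ℝ) :
    ∫⁻ x, B.indicator H (Fin.append t x) < ∞ ↔
      ∀ i, ∫⁻ x, (P i).indicator H (Fin.append t x) < ∞ :=
  ⟨fun h i => lt_of_le_of_lt (soloInformed_lintegral_indicator_append_mono (hPB i) H t) h,
    fun h => soloInformed_cover_lintegral_lt_top' P hPm hH hcov t h⟩

/-- **Loci through finite covers**: the locus over `B` is the intersection of the piece loci. -/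
theorem soloInformed_locus_of_cover {ι : Type} [Finite ι] {B : Set (Fin (k + d) → ℝ)}
    (P : ι → Set (Fin (k + d) → ℝ)) (hPB : ∀ i, P i ⊆ B) (hPm : ∀ i, MeasurableSet (P i))
    {H : (Fin (k + d) → ℝ) → ℝ≥0∞} (hH : Measurable H)
    (hcov : ∀ w ∈ B, H w = 0 ∨ ∃ i, w ∈ P i)
    (hloc : ∀ i, IsSemialgebraic ℚ {t : Fin k → ℝ |
      ∫⁻ x, (P i).indicator H (Fin.append t x) < ∞}) :
    IsSemialgebraic ℚ {t : Fin k → ℝ | ∫⁻ x, B.indicator H (Fin.append t x) < ∞} := by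
  have h : {t : Fin k → ℝ | ∫⁻ x, B.indicator H (Fin.append t x) < ∞} =
      {t | ∀ i, ∫⁻ x, (P i).indicator H (Fin.append t x) < ∞} := by
    ext t; exact soloInformed_finite_iff_cover P hPB hPm hH hcov t
  rw [h]
  haveI := Fintype.ofFinite ι
  exact soloInformed_isSemialgebraic_setOf_forall_fin hloc

/-! ### Null fibres: the chart `ℝᵏ × ℝᵈ ≅ ℝ^{k+d}` and the thin-fibre clause -/

/-- `Fin.append t x` is `Sum.elim t x` read through `finSumFinEquiv`. -/
theorem soloInformed_sumElim_comp_finSumFinEquiv_symm (t : Fin k → ℝ) (x : Fin d → ℝ) :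
    (Sum.elim t x) ∘ (finSumFinEquiv.symm : Fin (k + d) → Fin k ⊕ Fin d) = Fin.append t x := by
  funext i
  refine Fin.addCases (fun j => ?_) (fun j => ?_) i
  · rw [Function.comp_apply, finSumFinEquiv_symm_apply_castAdd, Sum.elim_inl, Fin.append_left]
  · rw [Function.comp_apply, finSumFinEquiv_symm_apply_natAdd, Sum.elim_inr, Fin.append_right]

/-- A set of `ℝ^{k+d}` in the coordinates `ℝᵏ ⊔ ℝᵈ`. -/
def soloInformedSumChart (Z : Set (Fin (k + d) → ℝ)) : Set (Fin k ⊕ Fin d → ℝ) :=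
  (fun u : Fin k ⊕ Fin d → ℝ => u ∘ (finSumFinEquiv.symm : Fin (k + d) → Fin k ⊕ Fin d)) ⁻¹' Z

/-- The chart of a `ℚ`-semialgebraic set is `ℚ`-semialgebraic. -/
theorem soloInformed_isSemialgebraic_sumChart {Z : Set (Fin (k + d) → ℝ)}
    (hZ : IsSemialgebraic ℚ Z) : IsSemialgebraic ℚ (soloInformedSumChart Z) :=
  hZ.preimage_comp _

/-- Fibres over `t` in the two coordinate systems agree. -/
theorem soloInformed_appendFibre_eq (Z : Set (Fin (k + d) → ℝ)) (t : Fin k → ℝ) :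
    {x : Fin d → ℝ | Fin.append t x ∈ Z} = {x | Sum.elim t x ∈ soloInformedSumChart Z} := by
  ext x
  simp only [mem_setOf_eq, soloInformedSumChart, mem_preimage,
    soloInformed_sumElim_comp_finSumFinEquiv_symm]

/-- **The fibre of a `ℚ`-semialgebraic set is null iff the thin-fibre clause holds.** -/
theorem soloInformed_volume_appendFibre_eq_zero_iff {Z : Set (Fin (k + d) → ℝ)}
    (hZ : IsSemialgebraic ℚ Z) (t : Fin k → ℝ) :
    volume {x : Fin d → ℝ | Fin.append t x ∈ Z} = 0 ↔
      soloInformedThin (soloInformedSumChart Z) t := by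
  rw [soloInformed_appendFibre_eq, soloInformed_thin_iff_interior_eq_empty]
  refine ⟨fun h => ?_, fun h => soloInformed_volume_eq_zero_of_interior_eq_empty
    (soloInformed_isSemialgebraic_real_fibre (soloInformed_isSemialgebraic_sumChart hZ) t) h⟩
  by_contra hne
  exact (Measure.measure_pos_of_nonempty_interior volume (nonempty_iff_ne_empty.2 hne)).ne' h

/-- **The null-fibre locus of a `ℚ`-semialgebraic set is `ℚ`-semialgebraic.** -/
theorem soloInformed_isSemialgebraic_setOf_volume_appendFibre {Z : Set (Fin (k + d) → ℝ)}
    (hZ : IsSemialgebraic ℚ Z) :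
    IsSemialgebraic ℚ {t : Fin k → ℝ | volume {x : Fin d → ℝ | Fin.append t x ∈ Z} = 0} := by
  have h : {t : Fin k → ℝ | volume {x : Fin d → ℝ | Fin.append t x ∈ Z} = 0} =
      {t | soloInformedThin (soloInformedSumChart Z) t} := by
    ext t; exact soloInformed_volume_appendFibre_eq_zero_iff hZ t
  rw [h]
  exact soloInformed_isSemialgebraic_setOf_thin (soloInformed_isSemialgebraic_sumChart hZ)

/-- **Null pieces**: if on `P` the integrand is `⊤` where `a ≠ 0` and `0` where `a = 0`, its
integral over the fibre is finite iff the fibre of `P ∩ {a ≠ 0}` is null. -/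
theorem soloInformed_finite_iff_volume_eq_zero {P : Set (Fin (k + d) → ℝ)}
    {a : (Fin (k + d) → ℝ) → ℝ} {H : (Fin (k + d) → ℝ) → ℝ≥0∞}
    (hZm : MeasurableSet {w | w ∈ P ∧ a w ≠ 0})
    (hH : ∀ w ∈ P, (a w = 0 → H w = 0) ∧ (a w ≠ 0 → H w = ⊤)) (t : Fin k → ℝ) :
    ∫⁻ x, P.indicator H (Fin.append t x) < ∞ ↔
      volume {x : Fin d → ℝ | Fin.append t x ∈ {w | w ∈ P ∧ a w ≠ 0}} = 0 := by
  have heq : (fun x : Fin d → ℝ => P.indicator H (Fin.append t x)) = fun x =>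
      {x : Fin d → ℝ | Fin.append t x ∈ {w | w ∈ P ∧ a w ≠ 0}}.indicator (fun _ => (⊤ : ℝ≥0∞)) x := by
    funext x
    by_cases hx : Fin.append t x ∈ P
    · by_cases ha : a (Fin.append t x) = 0
      · rw [indicator_of_mem hx, (hH _ hx).1 ha, indicator_of_notMem]
        exact fun h => h.2 ha
      · rw [indicator_of_mem hx, (hH _ hx).2 ha, indicator_of_mem]
        exact ⟨hx, ha⟩
    · rw [indicator_of_notMem hx, indicator_of_notMem]
      exact fun h => hx h.1
  have hmeas : MeasurableSet {x : Fin d → ℝ | Fin.append t x ∈ {w | w ∈ P ∧ a w ≠ 0}} :=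
    hZm.preimage (Literature.NumberTheory.Sieve.FordMaynard.measurable_append_right t)
  rw [show ∫⁻ x, P.indicator H (Fin.append t x) = ∫⁻ x, {x : Fin d → ℝ | Fin.append t x ∈
      {w | w ∈ P ∧ a w ≠ 0}}.indicator (fun _ => (⊤ : ℝ≥0∞)) x from congrArg (lintegral volume) heq,
    lintegral_indicator_const hmeas, ENNReal.mul_lt_top_iff]
  simp

/-! ### The locus bundle over a piece -/

/-- **Hypothesis bundle over a piece `P` for loci**: semialgebraicity, measurability and the
two-sided comparison of the mass `H₀` with `|a| · I`. -/
structure SoloInformedLocusHyp {n : ℕ} (P : Set (Fin n → ℝ)) (a : (Fin n → ℝ) → ℝ)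
    (H₀ I : (Fin n → ℝ) → ℝ≥0∞) (c : ℝ) : Prop where
  /-- the piece is `ℚ`-semialgebraic -/
  sa_P : IsSemialgebraic ℚ P
  /-- the coefficient is `ℚ`-semialgebraic on the piece -/
  sa_a : IsSemialgebraicFunOn ℚ P a
  /-- the mass is measurable -/
  meas_H₀ : Measurable H₀
  /-- the comparison constant is non-negative -/
  c_nonneg : 0 ≤ c
  /-- two-sided comparison `|a| I ≤ c H₀`, `H₀ ≤ c |a| I` on the piece -/
  hmass : ∀ w ∈ P, ENNReal.ofReal |a w| * I w ≤ ENNReal.ofReal c * H₀ w ∧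
    H₀ w ≤ ENNReal.ofReal (c * |a w|) * I w

namespace SoloInformedLocusHyp

variable {n : ℕ} {P : Set (Fin n → ℝ)} {a : (Fin n → ℝ) → ℝ} {H₀ I : (Fin n → ℝ) → ℝ≥0∞} {c : ℝ}

/-- Restriction of the bundle to a semialgebraic sub-piece. -/
theorem mono (h : SoloInformedLocusHyp P a H₀ I c) {P' : Set (Fin n → ℝ)} (hP' : P' ⊆ P)
    (hsa : IsSemialgebraic ℚ P') : SoloInformedLocusHyp P' a H₀ I c :=
  ⟨hsa, h.sa_a.mono hP' hsa, h.meas_H₀, h.c_nonneg, fun w hw => h.hmass w (hP' hw)⟩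

end SoloInformedLocusHyp

variable {P : Set (Fin (k + d) → ℝ)} {a : (Fin (k + d) → ℝ) → ℝ}
  {H₀ I : (Fin (k + d) → ℝ) → ℝ≥0∞} {c : ℝ}

/-- **NULL piece locus**: where `I = ⊤` on `P`, the locus is the null-fibre locus of
`P ∩ {a ≠ 0}`, hence `ℚ`-semialgebraic. -/
theorem soloInformed_locus_null (h : SoloInformedLocusHyp P a H₀ I c) (hI : ∀ w ∈ P, I w = ⊤) :
    IsSemialgebraic ℚ {t : Fin k → ℝ | ∫⁻ x, P.indicator H₀ (Fin.append t x) < ∞} := by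
  have hZ : IsSemialgebraic ℚ {w | w ∈ P ∧ a w ≠ 0} := by
    have h1 : {w | w ∈ P ∧ a w ≠ 0} = {w | w ∈ P ∧ a w < 0} ∪ {w | w ∈ P ∧ (-a) w < 0} := by
      ext w
      simp only [mem_setOf_eq, mem_union, Pi.neg_apply, neg_lt_zero]
      constructor
      · rintro ⟨hw, ha⟩
        rcases ha.lt_or_gt with h | h
        · exact Or.inl ⟨hw, h⟩
        · exact Or.inr ⟨hw, h⟩
      · rintro (⟨hw, h⟩ | ⟨hw, h⟩)
        · exact ⟨hw, h.ne⟩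
        · exact ⟨hw, h.ne'⟩
    rw [h1]
    exact h.sa_a.isSemialgebraic_sep_neg.union h.sa_a.neg.isSemialgebraic_sep_neg
  have hset : {t : Fin k → ℝ | ∫⁻ x, P.indicator H₀ (Fin.append t x) < ∞} =
      {t | volume {x : Fin d → ℝ | Fin.append t x ∈ {w | w ∈ P ∧ a w ≠ 0}} = 0} := by
    ext t
    refine soloInformed_finite_iff_volume_eq_zero hZ.measurableSet_holds (fun w hw => ?_) t
    obtain ⟨h1, h2⟩ := h.hmass w hw
    rw [hI w hw] at h1 h2
    refine ⟨fun ha => ?_, fun ha => ?_⟩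
    · rw [ha, abs_zero, mul_zero, ENNReal.ofReal_zero, zero_mul] at h2
      exact le_antisymm h2 (zero_le)
    · rw [ENNReal.mul_top (by rwa [Ne, ENNReal.ofReal_eq_zero, not_le, abs_pos])] at h1
      rw [top_le_iff, ENNReal.mul_eq_top] at h1
      rcases h1 with ⟨-, h1⟩ | ⟨h1, -⟩
      · exact h1
      · exact absurd h1 ENNReal.ofReal_ne_top
  rw [hset]
  exact soloInformed_isSemialgebraic_setOf_volume_appendFibre hZ

/-- **SURROGATE piece locus**: if `L S ≤ I ≤ T S` on `P` for a non-negative `ℚ`-semialgebraic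
`S`, the locus is that of `|a| S` one dimension down. -/
theorem soloInformed_locus_surrogate (ihI : SoloInformedFinLocusAt k d)
    (h : SoloInformedLocusHyp P a H₀ I c) {S : (Fin (k + d) → ℝ) → ℝ}
    (hS : IsSemialgebraicFunOn ℚ P S) (hS0 : ∀ w ∈ P, 0 ≤ S w) {T L : ℝ} (hT : 0 ≤ T)
    (hL : 0 < L) (hup : ∀ w ∈ P, I w ≤ ENNReal.ofReal (T * S w))
    (hlow : ∀ w ∈ P, ENNReal.ofReal (L * S w) ≤ I w) :
    IsSemialgebraic ℚ {t : Fin k → ℝ | ∫⁻ x, P.indicator H₀ (Fin.append t x) < ∞} := by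
  have hc := h.c_nonneg
  have hG : IsSemialgebraicFunOn ℚ P (fun w => a w * S w) :=
    (IsSemialgebraicFunOn.mul_holds h.sa_a hS).congr fun _ _ => rfl
  have key := ihI P (fun w => a w * S w) h.sa_P hG
  have hset : {t : Fin k → ℝ | ∫⁻ x, P.indicator H₀ (Fin.append t x) < ∞} =
      {t | ∫⁻ x, ENNReal.ofReal (P.indicator (fun w => |a w * S w|) (Fin.append t x)) < ∞} := by
    ext t
    simp only [mem_setOf_eq, soloInformed_ofReal_indicator]
    refine soloInformed_finite_iff_of_twoSided (K := ENNReal.ofReal (c * T))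
      (K' := ENNReal.ofReal (L⁻¹ * c)) ENNReal.ofReal_ne_top ENNReal.ofReal_ne_top
      (fun w hw => ?_) (fun w hw => ?_) t
    · obtain ⟨-, h2⟩ := h.hmass w hw
      calc H₀ w ≤ ENNReal.ofReal (c * |a w|) * I w := h2
        _ ≤ ENNReal.ofReal (c * |a w|) * ENNReal.ofReal (T * S w) := by gcongr; exact hup w hw
        _ = ENNReal.ofReal (c * T) * ENNReal.ofReal |a w * S w| := by
          rw [← ENNReal.ofReal_mul (by positivity), ← ENNReal.ofReal_mul (by positivity),
            abs_mul, abs_of_nonneg (hS0 w hw)]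
          ring_nf
    · obtain ⟨h1, -⟩ := h.hmass w hw
      have hx : ENNReal.ofReal (|a w * S w|) =
          ENNReal.ofReal L⁻¹ * (ENNReal.ofReal (|a w|) * ENNReal.ofReal (L * S w)) := by
        rw [← ENNReal.ofReal_mul (abs_nonneg _), ← ENNReal.ofReal_mul (by positivity),
          abs_mul, abs_of_nonneg (hS0 w hw)]
        congr 1
        field_simp
      calc ENNReal.ofReal (|a w * S w|)
          = ENNReal.ofReal L⁻¹ * (ENNReal.ofReal (|a w|) * ENNReal.ofReal (L * S w)) := hx
        _ ≤ ENNReal.ofReal L⁻¹ * (ENNReal.ofReal (|a w|) * I w) := by gcongr; exact hlow w hw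
        _ ≤ ENNReal.ofReal L⁻¹ * (ENNReal.ofReal c * H₀ w) := by gcongr
        _ = ENNReal.ofReal (L⁻¹ * c) * H₀ w := by
          rw [← mul_assoc, ← ENNReal.ofReal_mul (by positivity)]
  rw [hset]
  exact key

/-- **LOGARITHMIC piece locus**: if `1/2 ≤ I ≤ log q` on `P` with `q ≥ 1` `ℚ`-semialgebraic,
the locus is that of `|a|` one dimension down — the forward inclusion by `I ≥ 1/2`, the backward
one by the log-room theorem. -/
theorem soloInformed_locus_log (ihI : SoloInformedFinLocusAt k d) (ihT : SoloInformedLogRoomAt k d)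
    (h : SoloInformedLocusHyp P a H₀ I c) {q : (Fin (k + d) → ℝ) → ℝ}
    (hq : IsSemialgebraicFunOn ℚ P q) (hq1 : ∀ w ∈ P, 1 ≤ q w)
    (hup : ∀ w ∈ P, I w ≤ ENNReal.ofReal (Real.log (q w)))
    (hlow : ∀ w ∈ P, ENNReal.ofReal (1 / 2) ≤ I w) :
    IsSemialgebraic ℚ {t : Fin k → ℝ | ∫⁻ x, P.indicator H₀ (Fin.append t x) < ∞} := by
  have hc := h.c_nonneg
  have key := ihI P a h.sa_P h.sa_a
  have hset : {t : Fin k → ℝ | ∫⁻ x, P.indicator H₀ (Fin.append t x) < ∞} =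
      {t | ∫⁻ x, ENNReal.ofReal (P.indicator (fun w => |a w|) (Fin.append t x)) < ∞} := by
    ext t
    simp only [mem_setOf_eq, soloInformed_ofReal_indicator]
    constructor
    · intro hfin
      refine lt_of_le_of_lt (soloInformed_lintegral_indicator_append_le_mul
        (K := ENNReal.ofReal (2 * c)) ENNReal.ofReal_ne_top (fun w hw => ?_) t)
        (ENNReal.mul_lt_top ENNReal.ofReal_lt_top hfin)
      obtain ⟨h1, -⟩ := h.hmass w hw
      have hx : ENNReal.ofReal (|a w|) =
          ENNReal.ofReal 2 * (ENNReal.ofReal (|a w|) * ENNReal.ofReal (1 / 2)) := by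
        rw [mul_comm (ENNReal.ofReal (|a w|)), ← mul_assoc, ← ENNReal.ofReal_mul (by norm_num)]
        norm_num
      calc ENNReal.ofReal (|a w|)
          = ENNReal.ofReal 2 * (ENNReal.ofReal (|a w|) * ENNReal.ofReal (1 / 2)) := hx
        _ ≤ ENNReal.ofReal 2 * (ENNReal.ofReal (|a w|) * I w) := by gcongr; exact hlow w hw
        _ ≤ ENNReal.ofReal 2 * (ENNReal.ofReal c * H₀ w) := by gcongr
        _ = ENNReal.ofReal (2 * c) * H₀ w := by
          rw [← mul_assoc, ← ENNReal.ofReal_mul (by norm_num)]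
    · intro hfin
      -- the log-room theorem with `F = |a|`, `ρ = q`, `p = 1`
      have hT := ihT Unit 1 P (fun w => |a w|) (fun _ => q) t h.sa_P h.sa_a.abs (fun _ => hq)
        (fun w _ => abs_nonneg _)
        (by simpa only [abs_abs, soloInformed_ofReal_indicator] using hfin)
      simp only [Finset.univ_unique, Finset.sum_singleton, pow_one,
        soloInformed_ofReal_indicator] at hT
      refine lt_of_le_of_lt (soloInformed_lintegral_indicator_append_le_mul
        (K := ENNReal.ofReal c) ENNReal.ofReal_ne_top (fun w hw => ?_) t)
        (ENNReal.mul_lt_top ENNReal.ofReal_lt_top hT)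
      obtain ⟨-, h2⟩ := h.hmass w hw
      have hlog : 0 ≤ Real.log (q w) := Real.log_nonneg (hq1 w hw)
      calc H₀ w ≤ ENNReal.ofReal (c * |a w|) * I w := h2
        _ ≤ ENNReal.ofReal (c * |a w|) * ENNReal.ofReal (Real.log (q w)) := by
          gcongr; exact hup w hw
        _ ≤ ENNReal.ofReal (c * |a w|) * ENNReal.ofReal (1 + |Real.log (q w)|) := by
          gcongr; rw [abs_of_nonneg hlog]; linarith
        _ = ENNReal.ofReal c * ENNReal.ofReal (|a w| * (1 + |Real.log (q w)|)) := by
          rw [← ENNReal.ofReal_mul (by positivity), ← ENNReal.ofReal_mul hc]; ring_nf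
  rw [hset]
  exact key

end Summit.KontsevichZagierPeriods.KontsevichZagierPeriods.Theorems
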